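import Summits.Ventures.PercRepro.RankLevelSetContractMonoCore

/-!
# PercRepro — C-025 from the SAME-CELL DELETION MONOTONICITY of the slack on cores (night-1, gen 11)

A second local door for the crux `C025`, complementary to C-037 (`c025_of_contractMonoExistsCore`).

(MD′) at `e`: `σ_{M ＼ e}(p, q) ≤ σ_M(p, q)` — the slack `σ = #Y − Φ·#U` of the SAME cell `(p, q)` does not
increase when `e` is deleted.  Exactly: `σ_M(p,q) − σ_{M＼e}(p,q) = y(e) − Φ(p,q)·(a(e) + b(e))` with
`y(e) = #{S : e ∈ S, q < ρ(S) < p}`, `a(e) = #{A ∈ U(p,q) : e ∉ A}`, `b(e) = #{A ∈ U(p,q) : e ∈ A, e a coloop of A}`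
(identities of `RankLevelSetCross`; not needed for the reduction below, which uses only the slack form).

`c025_of_deleteMonoExistsCore`: if every simple, rank-`p`, coloop-free core strictly above the tight layer
(`|E| > p + q`) has SOME element `e` with (MD′), then `C025` holds — by strong induction on `|E|` with the
cell's wrapper (loops, parallel pairs, truncation, coloops, non-`e`-free elements, Theorem M on `|E| ≤ p + q`,
Theorem A at `q = 0`), exactly as in `c025_of_contractMonoExistsCore`.  The BASE of the deletion chain is the
tight layer `|E| = p + q` (Theorem M, every cell) — unlike (MC∃), whose diagonal instances `p = q + 2` are the
cells themselves.  `c025_of_eitherMonoExistsCore` takes the weaker hypothesis «(MD′) at some `e` OR (MC) at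
some `e`».

Evidence (night-1 g11, own exact code, mining/night-1/g11/): (MD′) holds at SOME element of EVERY simple
coloop-free core above the tight layer on ≤ 9 elements (n = 9: 382 / 185,913 / 185,913 / 188,319 / 188,319 /
188,319 / 875 / 875 / 26 cores at the cells (3,1) … (7,1), 0 cores without a door), at EVERY element except
1,660 of the 1,694,871 pairs (M, e) of the diagonal cell (5,3); it holds at every element lying in the maximum
number of circuits of size ≤ q + 1 (0 failures ≤ 9 elements), and at the points of the line on the families
T_p(U_{2,k} ⊕ U_{m,m}) for every cell tested (ratio → 1⁺ along k = n − p − q + 4).  The AVERAGED form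
(over all elements) is FALSE above the tight layer (T_p(U_{2,4} ⊕ U_{m,m}) at (p, q) = (6, 4): 0.9615).
-/

open scoped Matroid

namespace PercRepro

namespace ThmN

open Set

variable {α : Type}

/-- **(MD′∃) ON CORES**: for every simple, rank-`p`, coloop-free finite matroid in which every element admits an
`e`-free partition, every `q ≥ 1`, `q + 2 ≤ p` and `|E| > p + q`, some element `e` has
`σ_{M ＼ {e}}(p, q) ≤ σ_M(p, q)` (the slack of the SAME cell is deletion-monotone at `e`). -/
def DeleteMonoExistsCore : Prop :=
  ∀ {α : Type} (M : Matroid α) [M.Finite] (p q : ℕ), 1 ≤ q → q + 2 ≤ p →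
    (∀ e ∈ M.E, ∀ f ∈ M.E, e ≠ f → M.eRk {e, f} = 2) → M.eRank = (p : ℕ∞) →
    (∀ e, ¬ M.IsColoop e) →
    (∀ e ∈ M.E, ∃ A ⊆ M.E \ {e}, e ∉ M.closure A ∧ e ∉ M.closure ((M.E \ {e}) \ A)) →
    p + q < M.E.ncard →
    ∃ e ∈ M.E, Matroid.slack (M ＼ {e}) p q ≤ Matroid.slack M p q

/-- **THE COMBINED DOOR ON CORES**: on every core strictly above the tight layer some element `e` satisfies
(MD′) — `σ_{M ＼ {e}}(p, q) ≤ σ_M(p, q)` — or (MC) — `σ_{M ／ {e}}(p − 1, q) ≤ σ_M(p, q)`. -/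
def EitherMonoExistsCore : Prop :=
  ∀ {α : Type} (M : Matroid α) [M.Finite] (p q : ℕ), 1 ≤ q → q + 2 ≤ p →
    (∀ e ∈ M.E, ∀ f ∈ M.E, e ≠ f → M.eRk {e, f} = 2) → M.eRank = (p : ℕ∞) →
    (∀ e, ¬ M.IsColoop e) →
    (∀ e ∈ M.E, ∃ A ⊆ M.E \ {e}, e ∉ M.closure A ∧ e ∉ M.closure ((M.E \ {e}) \ A)) →
    p + q < M.E.ncard →
    ∃ e ∈ M.E, Matroid.slack (M ＼ {e}) p q ≤ Matroid.slack M p q ∨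
      Matroid.slack (M ／ {e}) (p - 1) q ≤ Matroid.slack M p q

/-- (MD′∃) on cores implies the combined door. -/
theorem eitherMonoExistsCore_of_deleteMonoExistsCore (h : DeleteMonoExistsCore) :
    EitherMonoExistsCore := by
  intro α M _ p q hq hpq hs hR hC hU hbig
  obtain ⟨e, he, hMD⟩ := h M p q hq hpq hs hR hC hU hbig
  exact ⟨e, he, Or.inl hMD⟩

/-- (MC∃) on cores implies the combined door. -/
theorem eitherMonoExistsCore_of_contractMonoExistsCore (h : ContractMonoExistsCore) :
    EitherMonoExistsCore := by
  intro α M _ p q hq hpq hs hR hC hU hbig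
  obtain ⟨e, he, hMC⟩ := h M p q hq hpq hs hR hC hU hbig
  exact ⟨e, he.mem_ground, Or.inr hMC⟩

/-- The deletion step: from (MD′) at `e` and `RLS` of the deletion at the same cell. -/
theorem RLS_of_delete_slack (M : Matroid α) [M.Finite] {p q : ℕ} {e : α}
    (hMD : Matroid.slack (M ＼ {e}) p q ≤ Matroid.slack M p q)
    (hIH : RLS (M ＼ {e}) p q) : RLS M p q := by
  rw [RLS_iff_slack_nonneg] at hIH ⊢
  exact le_trans hIH hMD

/-- **C-025 FROM THE COMBINED DOOR ON CORES** — strong induction on `|E|` for all `(p, q)` at once; the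
cell's reductions for everything that is not a core strictly above the tight layer; on a core the element of
the door gives `σ_M(p, q) ≥ σ_{M ＼ e}(p, q) ≥ 0` or `σ_M(p, q) ≥ σ_{M ／ e}(p − 1, q) ≥ 0`. -/
theorem c025_of_eitherMonoExistsCore (hcore : EitherMonoExistsCore) : C025 := by
  suffices H : ∀ n : ℕ, ∀ {α : Type} (M : Matroid α) [M.Finite], M.E.ncard = n → ∀ p q : ℕ, q + 2 ≤ p →
      RLS M p q by
    intro α M _ p q hpq
    exact H _ M rfl p q hpq
  intro n
  induction n using Nat.strong_induction_on with
  | _ n ih =>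
  intro α M _ hn p q hpq
  classical
  -- `q = 0` is Theorem A
  rcases Nat.eq_zero_or_pos q with hq0 | hq1
  · subst hq0
    exact c025_of_q_zero (M := M) p
  have hdel : ∀ e ∈ M.E, (M ＼ {e}).E.ncard < n := by
    intro e he
    rw [_root_.Matroid.delete_ground, ← hn, ← Set.ncard_sdiff_singleton_add_one he M.ground_finite]
    omega
  have hcon : ∀ e ∈ M.E, (M ／ {e}).E.ncard < n := by
    intro e he
    rw [_root_.Matroid.contract_ground, ← hn, ← Set.ncard_sdiff_singleton_add_one he M.ground_finite]
    omega
  -- Case 1: a loop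
  by_cases hL : ∃ e ∈ M.E, M.IsLoop e
  · obtain ⟨e, he, hloopE⟩ := hL
    exact RLS_of_loop_q M hloopE p q (ih _ (hdel e he) (M ＼ {e}) rfl p q hpq)
  push Not at hL
  -- Case 2: a parallel pair
  by_cases hP : ∃ e ∈ M.E, ∃ e' ∈ M.E, e' ≠ e ∧ e ∈ M.closure {e'}
  · obtain ⟨e, he, e', he', hne, hpar⟩ := hP
    have heI : M.Indep {e} := _root_.Matroid.indep_singleton.2 ((_root_.Matroid.not_isLoop_iff he).1 (hL e he))
    obtain ⟨p', rfl⟩ : ∃ p', p = p' + 1 := ⟨p - 1, by omega⟩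
    obtain ⟨q', rfl⟩ : ∃ q', q = q' + 1 := ⟨q - 1, by omega⟩
    exact RLS_of_parallel_q M heI he' hne hpar (ih _ (hdel e he) (M ＼ {e}) rfl (p' + 1) (q' + 1) hpq)
      (ih _ (hcon e he) (M ／ {e}) rfl p' q' (by omega))
  push Not at hP
  -- Case 3: simple
  have hs : ∀ e ∈ M.E, ∀ f ∈ M.E, e ≠ f → M.eRk {e, f} = 2 :=
    fun e he f hf hef => eRk_pair_eq_two_of_simple M hL (fun e he e' he' hne => hP e he e' he' hne) he hf hef
  -- the tight layer and below: Theorem M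
  rcases lt_trichotomy M.E.ncard (p + q) with hsmall | htight | hbig
  · exact RLS_of_ncard_lt M hsmall
  · exact RLS_of_ncard_eq M htight
  rcases lt_trichotomy M.eRank (p : ℕ∞) with hlt | heq | hgt
  · exact RLS_of_eRank_lt M hlt
  · -- `ρ(E) = p`
    by_cases hC : ∃ e, M.IsColoop e
    · obtain ⟨e, hcol⟩ := hC
      obtain ⟨p', rfl⟩ : ∃ p', p = p' + 1 := ⟨p - 1, by omega⟩
      obtain ⟨q', rfl⟩ : ∃ q', q = q' + 1 := ⟨q - 1, by omega⟩
      refine RLS_of_coloop_q M (by omega) hcol heq ?_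
      rcases Nat.lt_or_ge (q' + 2) p' with h | h
      · exact ih _ (hdel e hcol.mem_ground) (M ＼ {e}) rfl p' (q' + 1) (by omega)
      · exact RLS_of_le (M ＼ {e}) (by omega)
    · push Not at hC
      -- an element without an `e`-free partition closes the step
      by_cases hU : ∃ e ∈ M.E, ∀ A ⊆ M.E \ {e}, e ∈ M.closure A ∨ e ∈ M.closure ((M.E \ {e}) \ A)
      · obtain ⟨e, he, hunsp⟩ := hU
        have heI : M.Indep {e} := _root_.Matroid.indep_singleton.2 ((_root_.Matroid.not_isLoop_iff he).1 (hL e he))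
        obtain ⟨p', rfl⟩ : ∃ p', p = p' + 1 := ⟨p - 1, by omega⟩
        obtain ⟨q', rfl⟩ : ∃ q', q = q' + 1 := ⟨q - 1, by omega⟩
        exact RLS_of_unspanned_q M heI hunsp (ih _ (hdel e he) (M ＼ {e}) rfl (p' + 1) (q' + 1) hpq)
          (ih _ (hcon e he) (M ／ {e}) rfl p' q' (by omega))
      · push Not at hU
        -- the core: the element of the door
        obtain ⟨e, he, hdoor⟩ := hcore M p q hq1 hpq hs heq hC (fun e he => by
          obtain ⟨A, hA, h⟩ := hU e he
          exact ⟨A, hA, h.1, h.2⟩) hbig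
        rcases hdoor with hMD | hMC
        · exact RLS_of_delete_slack M hMD (ih _ (hdel e he) (M ＼ {e}) rfl p q hpq)
        · exact RLS_of_contract_slack M hpq hMC
            (fun hp => ih _ (hcon e he) (M ／ {e}) rfl (p - 1) q hp)
  · -- `ρ(E) > p`: truncate, then the same dichotomy on the truncation (same ground set)
    have hp2 : 2 ≤ p := by omega
    set T := Matroid.truncate M p with hTdef
    have hTs := truncate_pair_eRk M hp2 hs
    have hTR := truncate_eRank_eq M hgt
    have hTc := truncate_no_coloop M hgt
    have hTE : T.E = M.E := Matroid.truncate_ground M p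
    have hTn : T.E.ncard = n := by rw [hTE, hn]
    have hTbig : p + q < T.E.ncard := by rw [hTE]; exact hbig
    have hconT : ∀ e ∈ T.E, (T ／ {e}).E.ncard < n := by
      intro e he
      rw [_root_.Matroid.contract_ground, ← hTn, ← Set.ncard_sdiff_singleton_add_one he T.ground_finite]
      omega
    have hdelT : ∀ e ∈ T.E, (T ＼ {e}).E.ncard < n := by
      intro e he
      rw [_root_.Matroid.delete_ground, ← hTn, ← Set.ncard_sdiff_singleton_add_one he T.ground_finite]
      omega
    have hT : RLS T p q := by
      by_cases hU : ∃ e ∈ T.E, ∀ A ⊆ T.E \ {e}, e ∈ T.closure A ∨ e ∈ T.closure ((T.E \ {e}) \ A)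
      · obtain ⟨e, he, hunsp⟩ := hU
        have heT : T.Indep {e} := by
          rw [Matroid.truncate_indep_iff]
          refine ⟨_root_.Matroid.indep_singleton.2 ((_root_.Matroid.not_isLoop_iff (hTE ▸ he)).1 (hL e (hTE ▸ he))), ?_⟩
          rw [Set.ncard_singleton]; omega
        obtain ⟨p', rfl⟩ : ∃ p', p = p' + 1 := ⟨p - 1, by omega⟩
        obtain ⟨q', rfl⟩ : ∃ q', q = q' + 1 := ⟨q - 1, by omega⟩
        exact RLS_of_unspanned_q T heT hunsp (ih _ (hdelT e he) (T ＼ {e}) rfl (p' + 1) (q' + 1) hpq)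
          (ih _ (hconT e he) (T ／ {e}) rfl p' q' (by omega))
      · push Not at hU
        obtain ⟨e, he, hdoor⟩ := hcore T p q hq1 hpq hTs hTR hTc (fun e he => by
          obtain ⟨A, hA, h⟩ := hU e he
          exact ⟨A, hA, h.1, h.2⟩) hTbig
        rcases hdoor with hMD | hMC
        · exact RLS_of_delete_slack T hMD (ih _ (hdelT e he) (T ＼ {e}) rfl p q hpq)
        · exact RLS_of_contract_slack T hpq hMC
            (fun hp => ih _ (hconT e he) (T ／ {e}) rfl (p - 1) q hp)
    unfold RLS at hT ⊢
    exact Matroid.rls_of_truncate M p (by omega) (phiK p q) (by unfold phiK; positivity) hT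

/-- **C-025 FROM (MD′∃) ON CORES**: the same-cell deletion monotonicity of the slack at one element of every
core strictly above the tight layer closes the crux, with Theorem M as the base of the deletion chain. -/
theorem c025_of_deleteMonoExistsCore (h : DeleteMonoExistsCore) : C025 :=
  c025_of_eitherMonoExistsCore (eitherMonoExistsCore_of_deleteMonoExistsCore h)

/-- **C-025 FROM (MC∃) ON CORES**, again, through the combined door. -/
theorem c025_of_contractMonoExistsCore' (h : ContractMonoExistsCore) : C025 :=
  c025_of_eitherMonoExistsCore (eitherMonoExistsCore_of_contractMonoExistsCore h)

end ThmN

end PercRepro
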